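import Summits.ABC.IUTFork.Conditional.Layer3OfS
import Literature.AnabelianGeometry.SemiGraphs.TemperedCompactInVerticialFalseOfEscaping

/-!
# L3 LAYER CERTIFICATE — NEGATIVE bridges («v3» of `Conditional/Layer3OfS.lean`, kept in a sequel because the
# certificate file is at its 400-line cap)

abc-iut cell, branch C «CONDITIONAL VERIFICATION abc ⇐ S» (rung LADDER-ABC:A2.C); CERT-L3 of record = `Conditional/Layer3OfS.lean`
(abc-iut-w6-d045, p431644 / p434568 / p434887), whose resume point (HANDOFF 09:40Z; L3-lead α80: «v3 = ¬-bridges when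
`not_compactInVerticial` is ACCEPTED, any L3 seat may execute») this PROOF-ONLY file executes in BINDER form now, so that the final step
is a one-line instantiation: the L3 residual conjunctions `Layer3Residual` / `Layer3ResidualOfRecord` (hence `Layer3Cone`) have the
∀-countable named facts [SemiAnbd] Thm 3.7 (iii) `CompactInVerticial` (FACT-LIST F-1732) and Thm 3.7 (iv) `MaximalCompactIffVerticial`
(F-1750) as conjuncts, so the NEGATION of either refutes the residual (`layer3Residual_false_of_not_compactInVerticial`, …); and by
abc-iut-L3-t6's negative-modulo step (p432161, `VerticialLevelData.not_compactInVerticial_of_escaping`) an ESCAPING compact subgroup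
over any level data of any chart of any `𝒢` satisfying the hypotheses of Thm 3.7 refutes it (`layer3Residual_false_of_escaping`) — the
binder shape the FRONTIER programme SUBDAG-REFUTE-F1732 (plan/L3/SUBDAG-SemiAnbd-Thm37iii-REFUTE.md) produces at abc-iut-L3-d1's desk
countermodel `𝒢_θ` (kernel assembly abc-iut-L3-d4 `ThetaRayEscape.lean`, junction abc-iut-L3-t10).

SIBLINGS.  abc-iut-w4-d011's `Conditional/Layer3OfSResidualRefuted.lean` (p441107) refutes the LITERAL `Layer3Residual.{0}` outright
through its THIRD conjunct (`IwahoriWitness.not_cor39`, abc-iut-f-175 p439444: the literal `Cor39` typing); the bridges below go through the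
FIRST / SECOND conjuncts and therefore also reach the reading of record `Layer3ResidualOfRecord` (third conjunct `Cor39CompatUpToTwist`,
unaffected by the `Cor39` witness), which is what a landed `¬ CompactInVerticial.{0}` will refute.

HONEST FRAMING.  This file PROVES NOTHING about any graph and ASSERTS NOTHING: every theorem is an implication between named
propositions already in the tree.  The residual's reading AT FINITE GRAPHS — the reading at which every instantiated consumer of the
Cor 3.12 cone sits — is a hypothesis-free kernel theorem (`layer3ConeFinite_holds`, p434887) and is untouched.  Precisely (v2
wording, after abc-iut-w6-d045's RQ7 note): print STATES Thm 3.7 for connected COUNTABLE (quasi-coherent, totally elevated, totally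
estranged, verticially slim) `G` ([SemiAnbd] p. 40) and `Thm37Hypotheses` carries every printed hypothesis (plus the Galois-countability
of [IUTchI] Rmk. 2.5.3), so a landed `¬ CompactInVerticial.{0}` witnessed at a `𝒢_θ ⊨ Thm37Hypotheses` would be a kernel counterexample
to the typed reading of the printed COUNTABLE statement (erratum class for infinite semi-graphs; the printed PROOF, and the kernel theorem
`compactInVerticialAt_of_finiteGraph`, cover the finite case, which is the case IUT instantiates — finite dual semi-graphs).  Nothing here
bears on [IUTchIII] Cor. 3.12 itself; no side is taken. [claim: Mochizuki2012, status: disputed]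
-/

noncomputable section

namespace Summit.ABC.IUTFork.Conditional

open Literature.AnabelianGeometry.SemiGraphs

universe u₁ u₂ u₃ u₄ u₅

/-! ### ¬(iii) / ¬(iv) ⇒ ¬ residual -/

/-- `¬ CompactInVerticial` (∀-countable [SemiAnbd] Thm 3.7 (iii), F-1732) refutes the literal L3 residual.
[claim: Mochizuki2012, status: disputed] -/
theorem layer3Residual_false_of_not_compactInVerticial (h : ¬ ProfiniteSemiGraph.CompactInVerticial.{u₁}) :
    ¬ Layer3Residual.{u₁} :=
  fun hr => h hr.1

/-- `¬ MaximalCompactIffVerticial` (∀-countable [SemiAnbd] Thm 3.7 (iv), F-1750) refutes the literal L3 residual.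
[claim: Mochizuki2012, status: disputed] -/
theorem layer3Residual_false_of_not_maximalCompactIffVerticial
    (h : ¬ ProfiniteSemiGraph.MaximalCompactIffVerticial.{u₁}) : ¬ Layer3Residual.{u₁} :=
  fun hr => h hr.2.1

/-- `¬ CompactInVerticial` refutes the L3 residual under the readings of record. [claim: Mochizuki2012, status: disputed] -/
theorem layer3ResidualOfRecord_false_of_not_compactInVerticial (h : ¬ ProfiniteSemiGraph.CompactInVerticial.{u₁}) :
    ¬ Layer3ResidualOfRecord.{u₁} :=
  fun hr => h hr.1

/-- `¬ MaximalCompactIffVerticial` refutes the L3 residual under the readings of record. [claim: Mochizuki2012, status: disputed] -/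
theorem layer3ResidualOfRecord_false_of_not_maximalCompactIffVerticial
    (h : ¬ ProfiniteSemiGraph.MaximalCompactIffVerticial.{u₁}) : ¬ Layer3ResidualOfRecord.{u₁} :=
  fun hr => h hr.2.1

/-- `¬ CompactInVerticial` refutes the literal L3 cone conjunction `Layer3Cone = Layer3Discharged ∧ Layer3Residual` (its discharged half
`layer3Discharged_holds` is of course untouched). [claim: Mochizuki2012, status: disputed] -/
theorem layer3Cone_false_of_not_compactInVerticial (h : ¬ ProfiniteSemiGraph.CompactInVerticial.{u₁}) :
    ¬ Layer3Cone.{u₁, u₂, u₃, u₄, u₅} :=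
  fun hc => h hc.2.1

/-- Conversely the literal residual IMPLIES both ∀-countable facts, so it stands or falls with `CompactInVerticial`
(`layer3Residual_of_core` / `layer3Residual_thm37iv_of_iii` give the other direction modulo `Cor39`). [claim: Mochizuki2012, status: disputed] -/
theorem compactInVerticial_of_layer3Residual (hr : Layer3Residual.{u₁}) : ProfiniteSemiGraph.CompactInVerticial.{u₁} :=
  hr.1

/-! ### The negative-modulo bridge: an escaping compact subgroup refutes the residual -/

/-- **An ESCAPING compact subgroup refutes the L3 residual** (negative-modulo form, abc-iut-L3-t6 p432161): for ANY `𝒢` satisfying the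
hypotheses of [SemiAnbd] Thm 3.7, ANY chart `c`, ANY verticial level data `D` over it and ANY compact `C ≤ π₁^temp(𝒢)` moving every
compatible system of tree vertices at some level, `Layer3Residual` fails.  Nothing is constructed here; the FRONTIER programme
SUBDAG-REFUTE-F1732 supplies such a datum at `𝒢_θ` (universe `0`). [claim: Mochizuki2012, status: disputed] -/
theorem layer3Residual_false_of_escaping {𝒢 : ProfiniteSemiGraph.{u₁}} {c : ProfiniteSemiGraph.TemperedPiChart 𝒢}
    (D : ProfiniteSemiGraph.VerticialLevelData.{u₂} 𝒢 c) (h37 : 𝒢.Thm37Hypotheses) (C : Subgroup c.G)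
    (hC : IsCompact (C : Set c.G))
    (hesc : ∀ x : ∀ j, (D.tree j).Vertex, (∀ ⦃i j : D.J⦄ (h : i ≤ j), (D.trans h).vertexMap (x j) = x i) →
      ∃ g ∈ C, ∃ j, (D.act j g).hom.vertexMap (x j) ≠ x j) :
    ¬ Layer3Residual.{u₁} :=
  layer3Residual_false_of_not_compactInVerticial (D.not_compactInVerticial_of_escaping h37 C hC hesc)

/-- The same for the residual under the readings of record. [claim: Mochizuki2012, status: disputed] -/
theorem layer3ResidualOfRecord_false_of_escaping {𝒢 : ProfiniteSemiGraph.{u₁}} {c : ProfiniteSemiGraph.TemperedPiChart 𝒢}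
    (D : ProfiniteSemiGraph.VerticialLevelData.{u₂} 𝒢 c) (h37 : 𝒢.Thm37Hypotheses) (C : Subgroup c.G)
    (hC : IsCompact (C : Set c.G))
    (hesc : ∀ x : ∀ j, (D.tree j).Vertex, (∀ ⦃i j : D.J⦄ (h : i ≤ j), (D.trans h).vertexMap (x j) = x i) →
      ∃ g ∈ C, ∃ j, (D.act j g).hom.vertexMap (x j) ≠ x j) :
    ¬ Layer3ResidualOfRecord.{u₁} :=
  layer3ResidualOfRecord_false_of_not_compactInVerticial (D.not_compactInVerticial_of_escaping h37 C hC hesc)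

/-- The same for the literal cone conjunction. [claim: Mochizuki2012, status: disputed] -/
theorem layer3Cone_false_of_escaping {𝒢 : ProfiniteSemiGraph.{u₁}} {c : ProfiniteSemiGraph.TemperedPiChart 𝒢}
    (D : ProfiniteSemiGraph.VerticialLevelData.{u₂} 𝒢 c) (h37 : 𝒢.Thm37Hypotheses) (C : Subgroup c.G)
    (hC : IsCompact (C : Set c.G))
    (hesc : ∀ x : ∀ j, (D.tree j).Vertex, (∀ ⦃i j : D.J⦄ (h : i ≤ j), (D.trans h).vertexMap (x j) = x i) →
      ∃ g ∈ C, ∃ j, (D.act j g).hom.vertexMap (x j) ≠ x j) :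
    ¬ Layer3Cone.{u₁, u₂, u₃, u₄, u₅} :=
  layer3Cone_false_of_not_compactInVerticial (D.not_compactInVerticial_of_escaping h37 C hC hesc)

/-! ### The finite-graph reading is untouched -/

/-- Reminder, BY NAME: whatever happens to the ∀-countable typing, the L3 slice of the cone AT FINITE GRAPHS is a hypothesis-free
kernel theorem (`layer3ConeFinite_holds`, p434887). [claim: Mochizuki2012, status: disputed] -/
theorem layer3ConeFinite_holds' : Layer3Discharged.{u₁, u₂, u₃, u₄, u₅} ∧ Layer3ResidualFinite.{u₁} :=
  layer3ConeFinite_holds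

end Summit.ABC.IUTFork.Conditional

end
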